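import Summits.NavierStokesRegularity.NavierStokesRegularity.Theorems.EulerZoomLiouvillePowerGaugeEulerLiouvilleNeedleLogCapacityDisc
import Summits.NavierStokesRegularity.NavierStokesRegularity.Theorems.EulerZoomLiouvillePowerGaugeEulerLiouvilleNeedleDiscChart

/-!
# NEEDLE SLICES: the planar length–area bound on transversal discs, slab Tonelli in frame coordinates, good slices — plate t36d (1/2)
# (P2b of LEAD ns-typeII-p2 g10's needle corollary (N-a) for crux E `PowerGaugeEulerLiouville`, stmt-NavierStokesRegularity-19832)

LANDING PLATE prepared by nsreg-p2 g31 (cell ns-regularity-ideate; DIRECTOR-NS #168 (β) / #180 (4) / #184 (1); LEAD KEY 09:02:38Z)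
for a PROVER seat (`--supports stmt-NavierStokesRegularity-19832 --as helper`); the planner lands nothing.  Imports t36 2/2
(`…NeedleLogCapacityDisc`: `core_radius_le_of_area`) and t36c (`…NeedleDiscChart`: `discChart`, observables).  Theorems only
(no `def`, no notation), 0 sorries.  KERNEL TOOLS ONLY — no Euler / Navier–Stokes content.

CONTENT.  (1) SLICE LEMMAS — `core_radius_le_of_area` pulled back along a disc chart: generic observable with `‖f'‖² ≤ B`,
`∫_{D_δ} B ≤ 𝓔` (`slice_radius_le`); the RADIAL COMPONENT `−⟪e, V ∘ discChart⟫`, energy `∫_{D_δ}‖∇V‖²`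
(`slice_radius_le_radial`); the FLUX `−⟪y, V y⟫`, energy `2∫_{D_δ}|V|² + 2R²∫_{D_δ}‖∇V‖²` on a disc inside `‖y‖ ≤ R`
(`slice_radius_le_flux`).  (2) FRAMES: `orthonormal_frame` (from the six scalar relations) and its read-backs; SLAB TONELLI
`lintegral_slab_le`: for an orthonormal frame `(e, e₁, e₂)`, measurable `g ≥ 0`, and a disc family `discChart (t e) e₁ e₂ (D)`,
`t ∈ I`, inside a measurable `S`:  `∫⁻_{t∈I} ∫⁻_{z∈D} g (discChart (t e) e₁ e₂ z) ≤ ∫⁻_S g` — frame coordinates are the chain of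
standard measure-preserving equivalences `ℝ × ℂ ≃ ℝ × ℝ² ≃ (Fin 3 → ℝ) ≃ E3 ≃ E3` (`measurePreserving_frameCoords`,
`frameCoords_apply`; `OrthonormalBasis.measurePreserving_repr_symm`, `volume_preserving_piFinSuccAbove`,
`Complex.volume_preserving_equiv_pi`).  (3) GOOD SLICE by Chebyshev (`exists_good_slice`: on `(a, b)` some `t` has
`F t < 4X/(b−a)` and `G t < 4Y/(b−a)`); the fast-inflow speed bound `norm_ge_of_inflow` (`⟪y,Vy⟫ < −κ‖y‖² ⇒ κ‖y‖ ≤ |V y|`,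
Cauchy–Schwarz); `integral_sq_lt_of_lintegral_lt` (real form of a strict `lintegral` bound on a disc).
The composed thinness theorems are in `…NeedleThinness` (plate t36d 2/2).  [length–area method; Tonelli; Chebyshev — elementary]
-/

noncomputable section

set_option linter.dupNamespace false

open MeasureTheory Set Metric Real
open scoped RealInnerProductSpace ENNReal

namespace Summit.NavierStokesRegularity.NavierStokesRegularity.Theorems.PowerGaugeEulerLiouville.NeedleThinness

open NeedleLogCapacity NeedleDiscChart

/-! ## 1. Slice lemmas: the planar length–area bound pulled back to a transversal disc -/

/-- **Slice lemma, generic observable.**  `f : ℂ → ℝ` everywhere differentiable with continuous derivative,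
`‖f'‖² ≤ B` on the disc with `B` continuous and `∫_{D_δ} B ≤ 𝓔`; `f ≥ M` on the core `‖z‖ ≤ w`, the super-level
set `{f > m} ∩ D_δ` has area `≤ π(δ²−w²)/2`, `m < M`: then `w ≤ δ·exp(−π(M−m)²/𝓔)`. [length–area method] -/
theorem slice_radius_le {f : ℂ → ℝ} {f' : ℂ → ℂ →L[ℝ] ℝ} {B : ℂ → ℝ} {w δ m M 𝓔 : ℝ}
    (hw : 0 < w) (hwδ : w < δ) (hf : ∀ z, HasFDerivAt f (f' z) z) (hf' : Continuous f')
    (hB : Continuous B) (hfB : ∀ z ∈ ball (0 : ℂ) δ, ‖f' z‖ ^ 2 ≤ B z)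
    (hM : ∀ z : ℂ, ‖z‖ ≤ w → M ≤ f z) (hmM : m < M)
    (harea : volume {z : ℂ | ‖z‖ < δ ∧ m < f z} ≤ ENNReal.ofReal (π * (δ ^ 2 - w ^ 2) / 2))
    (hE : ∫ z in ball (0 : ℂ) δ, B z ≤ 𝓔) :
    w ≤ δ * Real.exp (-(π * (M - m) ^ 2 / 𝓔)) := by
  have hint : IntegrableOn B (ball (0 : ℂ) δ) :=
    (hB.continuousOn.integrableOn_compact (isCompact_closedBall (0 : ℂ) δ)).mono_set ball_subset_closedBall
  have hE' : ∫ z in ball (0 : ℂ) δ, ‖f' z‖ ^ 2 ≤ 𝓔 := by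
    refine le_trans (integral_mono_of_nonneg (Filter.Eventually.of_forall fun z => sq_nonneg ‖f' z‖) hint
      ?_) hE
    exact (ae_restrict_iff' measurableSet_ball).2 (Filter.Eventually.of_forall hfB)
  exact core_radius_le_of_area hw hwδ (fun z _ => hf z) hf'.continuousOn
    (fun z hz => hM z (mem_closedBall_zero_iff.mp hz)) hmM harea hE'

/-- **Slice lemma, radial-component observable** `f = −⟪e, V ∘ discChart⟫` (`‖e‖ = 1`, orthonormal frame):
energy `= ∫_{D_δ} ‖∇V‖²` on the disc. -/
theorem slice_radius_le_radial {V : (EuclideanSpace ℝ (Fin 3)) → (EuclideanSpace ℝ (Fin 3))} {V' : (EuclideanSpace ℝ (Fin 3)) → (EuclideanSpace ℝ (Fin 3)) →L[ℝ] (EuclideanSpace ℝ (Fin 3))} (hV : ∀ y, HasFDerivAt V (V' y) y)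
    (hV'c : Continuous V') {c e e₁ e₂ : (EuclideanSpace ℝ (Fin 3))} (he : ‖e‖ = 1) (h₁ : ‖e₁‖ = 1) (h₂ : ‖e₂‖ = 1)
    (h12 : ⟪e₁, e₂⟫ = 0) {w δ m M 𝓔 : ℝ} (hw : 0 < w) (hwδ : w < δ)
    (hM : ∀ z : ℂ, ‖z‖ ≤ w → M ≤ -⟪e, V (discChart c e₁ e₂ z)⟫) (hmM : m < M)
    (harea : volume {z : ℂ | ‖z‖ < δ ∧ m < -⟪e, V (discChart c e₁ e₂ z)⟫} ≤
      ENNReal.ofReal (π * (δ ^ 2 - w ^ 2) / 2))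
    (hE : ∫ z in ball (0 : ℂ) δ, ‖V' (discChart c e₁ e₂ z)‖ ^ 2 ≤ 𝓔) :
    w ≤ δ * Real.exp (-(π * (M - m) ^ 2 / 𝓔)) := by
  have hφ := continuous_discChart c e₁ e₂
  refine slice_radius_le (f := fun z => -⟪e, V (discChart c e₁ e₂ z)⟫)
    (f' := fun z => -(((innerSL ℝ e).comp (V' (discChart c e₁ e₂ z))).comp (discChartL e₁ e₂)))
    (B := fun z => ‖V' (discChart c e₁ e₂ z)‖ ^ 2) hw hwδ ?_ ?_ ?_ ?_ hM hmM harea hE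
  · intro z
    have h := (hasFDerivAt_linearObservable (innerSL ℝ e) c e₁ e₂ (hV (discChart c e₁ e₂ z))).neg
    simpa only [innerSL_apply_apply, Pi.neg_def] using h
  · exact ((continuous_const.clm_comp (hV'c.comp hφ)).clm_comp continuous_const).neg
  · exact (hV'c.comp hφ).norm.pow 2
  · intro z _
    rw [norm_neg]
    exact pow_le_pow_left₀ (norm_nonneg _) (norm_radialObservableDeriv_le he h₁ h₂ h12) 2

/-- **Slice lemma, flux observable** `f = −⟪discChart, V ∘ discChart⟫` (the portrait's `−⟪y, V y⟫`): energy
`= 2∫_{D_δ}|V|² + 2R² ∫_{D_δ}‖∇V‖²` on a disc contained in `‖y‖ ≤ R`. -/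
theorem slice_radius_le_flux {V : (EuclideanSpace ℝ (Fin 3)) → (EuclideanSpace ℝ (Fin 3))} {V' : (EuclideanSpace ℝ (Fin 3)) → (EuclideanSpace ℝ (Fin 3)) →L[ℝ] (EuclideanSpace ℝ (Fin 3))} (hV : ∀ y, HasFDerivAt V (V' y) y)
    (hV'c : Continuous V') {c e₁ e₂ : (EuclideanSpace ℝ (Fin 3))} (h₁ : ‖e₁‖ = 1) (h₂ : ‖e₂‖ = 1) (h12 : ⟪e₁, e₂⟫ = 0)
    {w δ m M R 𝓐s 𝓔s : ℝ} (hw : 0 < w) (hwδ : w < δ)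
    (hR : ∀ z ∈ ball (0 : ℂ) δ, ‖discChart c e₁ e₂ z‖ ≤ R)
    (hM : ∀ z : ℂ, ‖z‖ ≤ w → M ≤ -⟪discChart c e₁ e₂ z, V (discChart c e₁ e₂ z)⟫) (hmM : m < M)
    (harea : volume {z : ℂ | ‖z‖ < δ ∧ m < -⟪discChart c e₁ e₂ z, V (discChart c e₁ e₂ z)⟫} ≤
      ENNReal.ofReal (π * (δ ^ 2 - w ^ 2) / 2))
    (hEV : ∫ z in ball (0 : ℂ) δ, ‖V (discChart c e₁ e₂ z)‖ ^ 2 ≤ 𝓐s)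
    (hEV' : ∫ z in ball (0 : ℂ) δ, ‖V' (discChart c e₁ e₂ z)‖ ^ 2 ≤ 𝓔s) :
    w ≤ δ * Real.exp (-(π * (M - m) ^ 2 / (2 * 𝓐s + 2 * R ^ 2 * 𝓔s))) := by
  have hφ := continuous_discChart c e₁ e₂
  have hVc : Continuous V := continuous_iff_continuousAt.2 fun y => (hV y).continuousAt
  have hR0 : 0 ≤ R := by
    have h0 : (0 : ℂ) ∈ ball (0 : ℂ) δ := mem_ball_self (hw.trans hwδ)
    exact (norm_nonneg _).trans (hR 0 h0)
  have hiV : IntegrableOn (fun z => ‖V (discChart c e₁ e₂ z)‖ ^ 2) (ball (0 : ℂ) δ) :=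
    (((hVc.comp hφ).norm.pow 2).continuousOn.integrableOn_compact (isCompact_closedBall (0 : ℂ) δ)).mono_set
      ball_subset_closedBall
  have hiV' : IntegrableOn (fun z => ‖V' (discChart c e₁ e₂ z)‖ ^ 2) (ball (0 : ℂ) δ) :=
    (((hV'c.comp hφ).norm.pow 2).continuousOn.integrableOn_compact (isCompact_closedBall (0 : ℂ) δ)).mono_set
      ball_subset_closedBall
  refine slice_radius_le (f := fun z => -⟪discChart c e₁ e₂ z, V (discChart c e₁ e₂ z)⟫)
    (f' := fun z => -(fluxObservableDeriv c e₁ e₂ z (V (discChart c e₁ e₂ z)) (V' (discChart c e₁ e₂ z))))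
    (B := fun z => 2 * ‖V (discChart c e₁ e₂ z)‖ ^ 2 + 2 * R ^ 2 * ‖V' (discChart c e₁ e₂ z)‖ ^ 2)
    hw hwδ ?_ ?_ ?_ ?_ hM hmM harea ?_
  · exact fun z => (hasFDerivAt_fluxObservable c e₁ e₂ (hV _)).neg
  · have hc : Continuous fun z =>
        fluxObservableDeriv c e₁ e₂ z (V (discChart c e₁ e₂ z)) (V' (discChart c e₁ e₂ z)) := by
      unfold fluxObservableDeriv
      exact (((innerSL ℝ).continuous.comp (hVc.comp hφ)).clm_comp continuous_const).add
        (((innerSL ℝ).continuous.comp hφ).clm_comp ((hV'c.comp hφ).clm_comp continuous_const))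
    exact hc.neg
  · exact (continuous_const.mul ((hVc.comp hφ).norm.pow 2)).add
      (continuous_const.mul ((hV'c.comp hφ).norm.pow 2))
  · intro z hz
    rw [norm_neg]
    have h := norm_fluxObservableDeriv_sq_le (c := c) h₁ h₂ h12 z (V (discChart c e₁ e₂ z))
      (V' (discChart c e₁ e₂ z))
    have hy : ‖discChart c e₁ e₂ z‖ ≤ R := hR z hz
    have h2 : (‖discChart c e₁ e₂ z‖ * ‖V' (discChart c e₁ e₂ z)‖) ^ 2 ≤
        R ^ 2 * ‖V' (discChart c e₁ e₂ z)‖ ^ 2 := by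
      rw [mul_pow]
      exact mul_le_mul_of_nonneg_right (pow_le_pow_left₀ (norm_nonneg _) hy 2) (sq_nonneg _)
    linarith
  · have h1 : ∫ z in ball (0 : ℂ) δ, (2 * ‖V (discChart c e₁ e₂ z)‖ ^ 2 +
          2 * R ^ 2 * ‖V' (discChart c e₁ e₂ z)‖ ^ 2) =
        2 * (∫ z in ball (0 : ℂ) δ, ‖V (discChart c e₁ e₂ z)‖ ^ 2) +
          2 * R ^ 2 * (∫ z in ball (0 : ℂ) δ, ‖V' (discChart c e₁ e₂ z)‖ ^ 2) := by
      rw [integral_add (hiV.const_mul 2) (hiV'.const_mul (2 * R ^ 2)), integral_const_mul, integral_const_mul]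
    rw [h1]
    have hR2 : 0 ≤ 2 * R ^ 2 := by positivity
    nlinarith [mul_le_mul_of_nonneg_left hEV' hR2]

/-! ## 2. Integration over a slab of transversal discs (Fubini in frame coordinates) -/

section Slab

variable {e e₁ e₂ : (EuclideanSpace ℝ (Fin 3))}

/-- An orthonormal frame from the six scalar relations. -/
theorem orthonormal_frame (he : ‖e‖ = 1) (h₁ : ‖e₁‖ = 1) (h₂ : ‖e₂‖ = 1) (he1 : ⟪e, e₁⟫ = 0)
    (he2 : ⟪e, e₂⟫ = 0) (h12 : ⟪e₁, e₂⟫ = 0) : Orthonormal ℝ ![e, e₁, e₂] := by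
  classical
  have he1' : ⟪e₁, e⟫ = 0 := (real_inner_comm e e₁).trans he1
  have he2' : ⟪e₂, e⟫ = 0 := (real_inner_comm e e₂).trans he2
  have h12' : ⟪e₂, e₁⟫ = 0 := (real_inner_comm e₁ e₂).trans h12
  rw [orthonormal_iff_ite]
  intro i j
  fin_cases i <;> fin_cases j <;> simp [he, h₁, h₂, he1, he2, h12, he1', he2', h12']

/-- First frame vector is a unit vector. -/
theorem norm_frame₀ (hon : Orthonormal ℝ ![e, e₁, e₂]) : ‖e‖ = 1 := by simpa using hon.1 0
/-- Second frame vector is a unit vector. -/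
theorem norm_frame₁ (hon : Orthonormal ℝ ![e, e₁, e₂]) : ‖e₁‖ = 1 := by simpa using hon.1 1
/-- Third frame vector is a unit vector. -/
theorem norm_frame₂ (hon : Orthonormal ℝ ![e, e₁, e₂]) : ‖e₂‖ = 1 := by simpa using hon.1 2
/-- Frame vectors 0 and 1 are orthogonal. -/
theorem inner_frame₀₁ (hon : Orthonormal ℝ ![e, e₁, e₂]) : ⟪e, e₁⟫ = 0 := by
  simpa using hon.2 (show (0 : Fin 3) ≠ 1 by decide)
/-- Frame vectors 0 and 2 are orthogonal. -/
theorem inner_frame₀₂ (hon : Orthonormal ℝ ![e, e₁, e₂]) : ⟪e, e₂⟫ = 0 := by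
  simpa using hon.2 (show (0 : Fin 3) ≠ 2 by decide)
/-- Frame vectors 1 and 2 are orthogonal. -/
theorem inner_frame₁₂ (hon : Orthonormal ℝ ![e, e₁, e₂]) : ⟪e₁, e₂⟫ = 0 := by
  simpa using hon.2 (show (1 : Fin 3) ≠ 2 by decide)

/-- `Fin 3` has the cardinality of the dimension of `ℝ³`. -/
theorem card_fin_three_eq_finrank : Fintype.card (Fin 3) = Module.finrank ℝ (EuclideanSpace ℝ (Fin 3)) := by simp

/-- An orthonormal triple spans `ℝ³`. -/
theorem top_le_span_frame (hon : Orthonormal ℝ ![e, e₁, e₂]) : ⊤ ≤ Submodule.span ℝ (Set.range ![e, e₁, e₂]) := by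
  rw [← coe_basisOfOrthonormalOfCardEqFinrank hon card_fin_three_eq_finrank]
  exact (basisOfOrthonormalOfCardEqFinrank hon card_fin_three_eq_finrank).span_eq.ge

/-- FRAME COORDINATES of an orthonormal basis `b` of `ℝ³`, `(t, z) ↦ t b₀ + (re z) b₁ + (im z) b₂`, written as the
chain of standard measure-preserving equivalences `ℝ × ℂ → ℝ × ℝ² → ℝ³ → (EuclideanSpace ℝ (Fin 3)) → (EuclideanSpace ℝ (Fin 3))`, preserve Lebesgue measure. -/
theorem measurePreserving_frameCoords (b : OrthonormalBasis (Fin 3) ℝ (EuclideanSpace ℝ (Fin 3))) :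
    MeasurePreserving (⇑b.repr.symm ∘ WithLp.toLp 2 ∘ ⇑(MeasurableEquiv.piFinSuccAbove (fun _ : Fin 3 => ℝ) 0).symm ∘
      Prod.map id ⇑Complex.measurableEquivPi) := by
  refine b.measurePreserving_repr_symm.comp ?_
  refine (PiLp.volume_preserving_toLp (Fin 3)).comp ?_
  refine (MeasurePreserving.symm _ (volume_preserving_piFinSuccAbove (fun _ : Fin 3 => ℝ) 0)).comp ?_
  exact (MeasurePreserving.id volume).prod Complex.volume_preserving_equiv_pi

/-- The frame-coordinate map evaluated: `(t, z) ↦ t b₀ + (re z) b₁ + (im z) b₂`. -/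
theorem frameCoords_apply (b : OrthonormalBasis (Fin 3) ℝ (EuclideanSpace ℝ (Fin 3))) (t : ℝ) (z : ℂ) :
    (⇑b.repr.symm ∘ WithLp.toLp 2 ∘ ⇑(MeasurableEquiv.piFinSuccAbove (fun _ : Fin 3 => ℝ) 0).symm ∘
      Prod.map id ⇑Complex.measurableEquivPi) (t, z) = discChart (t • b 0) (b 1) (b 2) z := by
  have h1 : (⇑b.repr.symm ∘ WithLp.toLp 2 ∘ ⇑(MeasurableEquiv.piFinSuccAbove (fun _ : Fin 3 => ℝ) 0).symm ∘
      Prod.map id ⇑Complex.measurableEquivPi) (t, z) = b.repr.symm (WithLp.toLp 2 ![t, z.re, z.im]) := by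
    simp only [Function.comp_apply, Prod.map_apply, id, Complex.measurableEquivPi_apply,
      MeasurableEquiv.piFinSuccAbove_symm_apply, Fin.insertNthEquiv_zero]
    rfl
  rw [h1, ← OrthonormalBasis.sum_repr_symm, Fin.sum_univ_three]
  simp [discChart]

/-- Joint continuity of the slab parametrisation `(t, z) ↦ discChart (t e) e₁ e₂ z`. -/
theorem continuous_discChart₂ (e e₁ e₂ : (EuclideanSpace ℝ (Fin 3))) :
    Continuous fun p : ℝ × ℂ => discChart (p.1 • e) e₁ e₂ p.2 := by
  have h : (fun p : ℝ × ℂ => discChart (p.1 • e) e₁ e₂ p.2) = fun p => p.1 • e + discChartL e₁ e₂ p.2 := by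
    funext p; rw [discChart_eq]
  rw [h]
  exact (continuous_fst.smul continuous_const).add ((discChartL e₁ e₂).continuous.comp continuous_snd)

/-- **Slab integration.**  For measurable `g ≥ 0` and a family of transversal discs `discChart (t e) e₁ e₂ (D)`,
`t ∈ I`, all contained in a measurable set `S`: `∫_{t ∈ I} ∫_{z ∈ D} g(discChart (t e) e₁ e₂ z) ≤ ∫_S g`
(Tonelli in frame coordinates; the frame map preserves Lebesgue measure). -/
theorem lintegral_slab_le (hon : Orthonormal ℝ ![e, e₁, e₂]) {g : (EuclideanSpace ℝ (Fin 3)) → ℝ≥0∞} (hg : Measurable g)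
    {I : Set ℝ} (hI : MeasurableSet I) {D : Set ℂ} (hD : MeasurableSet D) {S : Set (EuclideanSpace ℝ (Fin 3))}
    (hS : MeasurableSet S) (hmaps : ∀ t ∈ I, ∀ z ∈ D, discChart (t • e) e₁ e₂ z ∈ S) :
    ∫⁻ t in I, ∫⁻ z in D, g (discChart (t • e) e₁ e₂ z) ≤ ∫⁻ y in S, g y := by
  set b : OrthonormalBasis (Fin 3) ℝ (EuclideanSpace ℝ (Fin 3)) := OrthonormalBasis.mk hon (top_le_span_frame hon) with hbdef
  have hb : ⇑b = ![e, e₁, e₂] := OrthonormalBasis.coe_mk _ _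
  have hb0 : b 0 = e := by rw [hb]; rfl
  have hb1 : b 1 = e₁ := by rw [hb]; rfl
  have hb2 : b 2 = e₂ := by rw [hb]; rfl
  set Ψ : ℝ × ℂ → (EuclideanSpace ℝ (Fin 3)) := ⇑b.repr.symm ∘ WithLp.toLp 2 ∘
    ⇑(MeasurableEquiv.piFinSuccAbove (fun _ : Fin 3 => ℝ) 0).symm ∘ Prod.map id ⇑Complex.measurableEquivPi with hΨdef
  have hΨ : MeasurePreserving Ψ := measurePreserving_frameCoords b
  have hΨapply : ∀ (t : ℝ) (z : ℂ), Ψ (t, z) = discChart (t • e) e₁ e₂ z := by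
    intro t z
    rw [hΨdef, frameCoords_apply, hb0, hb1, hb2]
  have hGm : Measurable (S.indicator g) := hg.indicator hS
  have hcomp : Measurable fun p : ℝ × ℂ => S.indicator g (Ψ p) := hGm.comp hΨ.measurable
  calc ∫⁻ t in I, ∫⁻ z in D, g (discChart (t • e) e₁ e₂ z)
      ≤ ∫⁻ t in I, ∫⁻ z, S.indicator g (Ψ (t, z)) := by
        refine setLIntegral_mono' hI fun t ht => ?_
        calc ∫⁻ z in D, g (discChart (t • e) e₁ e₂ z) = ∫⁻ z in D, S.indicator g (Ψ (t, z)) :=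
              setLIntegral_congr_fun hD fun z hz => by
                rw [hΨapply, indicator_of_mem (hmaps t ht z hz)]
          _ ≤ ∫⁻ z, S.indicator g (Ψ (t, z)) := setLIntegral_le_lintegral _ _
    _ ≤ ∫⁻ t, ∫⁻ z, S.indicator g (Ψ (t, z)) := setLIntegral_le_lintegral _ _
    _ = ∫⁻ p : ℝ × ℂ, S.indicator g (Ψ p) := by
        rw [Measure.volume_eq_prod]
        exact (lintegral_prod _ hcomp.aemeasurable).symm
    _ = ∫⁻ y, S.indicator g y := hΨ.lintegral_comp hGm
    _ = ∫⁻ y in S, g y := lintegral_indicator hS _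

end Slab

/-! ## 3. A good slice (Chebyshev in the slab variable) -/

/-- **Good slice.**  If `∫_{t ∈ (a, b)} F ≤ X` and `∫_{t ∈ (a, b)} G ≤ Y`, some `t ∈ (a, b)` has
`F t < 4X/(b − a)` and `G t < 4Y/(b − a)` (each bad set has measure `≤ (b − a)/4`; Chebyshev). -/
theorem exists_good_slice {F G : ℝ → ℝ≥0∞} (hF : Measurable F) (hG : Measurable G) {a b X Y : ℝ}
    (hab : a < b) (hX : 0 < X) (hY : 0 < Y)
    (hIF : ∫⁻ t in Ioo a b, F t ≤ ENNReal.ofReal X) (hIG : ∫⁻ t in Ioo a b, G t ≤ ENNReal.ofReal Y) :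
    ∃ t ∈ Ioo a b, F t < ENNReal.ofReal (4 * X / (b - a)) ∧ G t < ENNReal.ofReal (4 * Y / (b - a)) := by
  set I : Set ℝ := Ioo a b with hI
  have hℓ : 0 < b - a := sub_pos.2 hab
  -- Chebyshev on the restricted measure
  have cheb : ∀ {H : ℝ → ℝ≥0∞}, Measurable H → ∀ {Z : ℝ}, 0 < Z →
      ∫⁻ t in I, H t ≤ ENNReal.ofReal Z →
      volume.restrict I {t | ENNReal.ofReal (4 * Z / (b - a)) ≤ H t} ≤ ENNReal.ofReal ((b - a) / 4) := by
    intro H hH Z hZ hIH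
    have h := (mul_meas_ge_le_lintegral₀ (μ := volume.restrict I) hH.aemeasurable
      (ENNReal.ofReal (4 * Z / (b - a)))).trans hIH
    have hc : ENNReal.ofReal (4 * Z / (b - a)) ≠ 0 := (ENNReal.ofReal_pos.2 (by positivity)).ne'
    have hc' : ENNReal.ofReal (4 * Z / (b - a)) ≠ ∞ := ENNReal.ofReal_ne_top
    calc volume.restrict I {t | ENNReal.ofReal (4 * Z / (b - a)) ≤ H t}
        ≤ ENNReal.ofReal Z / ENNReal.ofReal (4 * Z / (b - a)) := by
          rw [ENNReal.le_div_iff_mul_le (Or.inl hc) (Or.inl hc'), mul_comm]; exact h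
      _ = ENNReal.ofReal ((b - a) / 4) := by
          rw [← ENNReal.ofReal_div_of_pos (by positivity)]
          congr 1
          field_simp
  have hbF := cheb hF hX hIF
  have hbG := cheb hG hY hIG
  set bad : Set ℝ := {t | ENNReal.ofReal (4 * X / (b - a)) ≤ F t} ∪ {t | ENNReal.ofReal (4 * Y / (b - a)) ≤ G t}
    with hbad
  have hbadm : MeasurableSet bad :=
    (measurableSet_le measurable_const hF).union (measurableSet_le measurable_const hG)
  have hμbad : volume.restrict I bad ≤ ENNReal.ofReal ((b - a) / 2) := by
    calc volume.restrict I bad ≤ volume.restrict I {t | ENNReal.ofReal (4 * X / (b - a)) ≤ F t} +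
          volume.restrict I {t | ENNReal.ofReal (4 * Y / (b - a)) ≤ G t} := measure_union_le _ _
      _ ≤ ENNReal.ofReal ((b - a) / 4) + ENNReal.ofReal ((b - a) / 4) := add_le_add hbF hbG
      _ = ENNReal.ofReal ((b - a) / 2) := by
          rw [← ENNReal.ofReal_add (by positivity) (by positivity)]
          congr 1
          ring
  have hμuniv : volume.restrict I univ = ENNReal.ofReal (b - a) := by
    rw [Measure.restrict_apply_univ, hI, Real.volume_Ioo]
  have hpos : volume.restrict I badᶜ ≠ 0 := by
    intro h0
    have h1 : volume.restrict I univ ≤ volume.restrict I bad + volume.restrict I badᶜ := by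
      rw [← union_compl_self bad]
      exact measure_union_le _ _
    rw [h0, add_zero, hμuniv] at h1
    have h2 : ENNReal.ofReal (b - a) ≤ ENNReal.ofReal ((b - a) / 2) := h1.trans hμbad
    rw [ENNReal.ofReal_le_ofReal_iff (by positivity)] at h2
    linarith
  have hne : (badᶜ ∩ I).Nonempty := by
    apply nonempty_of_measure_ne_zero (μ := volume)
    rwa [Measure.restrict_apply hbadm.compl] at hpos
  obtain ⟨t, htbad, htI⟩ := hne
  refine ⟨t, htI, ?_, ?_⟩
  · exact not_le.1 fun h => htbad (Or.inl h)
  · exact not_le.1 fun h => htbad (Or.inr h)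

/-! ## 4. The needle thinness bound -/

/-- On the fast-inflow set `⟪y, V y⟫ < −κ‖y‖²` the speed is at least `κ‖y‖` (Cauchy–Schwarz). -/
theorem norm_ge_of_inflow {V : (EuclideanSpace ℝ (Fin 3)) → (EuclideanSpace ℝ (Fin 3))} {κ : ℝ} {y : (EuclideanSpace ℝ (Fin 3))} (hy : ⟪y, V y⟫ < -(κ * ‖y‖ ^ 2)) :
    κ * ‖y‖ ≤ ‖V y‖ := by
  have hcs : |⟪y, V y⟫| ≤ ‖y‖ * ‖V y‖ := abs_real_inner_le_norm y (V y)
  have h1 : κ * ‖y‖ ^ 2 < ‖y‖ * ‖V y‖ := by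
    have := neg_abs_le ⟪y, V y⟫
    linarith
  by_cases hy0 : ‖y‖ = 0
  · rw [hy0, mul_zero]; exact norm_nonneg _
  · have hpos : 0 < ‖y‖ := lt_of_le_of_ne (norm_nonneg _) (Ne.symm hy0)
    have h2 : κ * ‖y‖ ^ 2 < ‖V y‖ * ‖y‖ := by linarith [mul_comm ‖y‖ ‖V y‖]
    nlinarith

/-- Real form of a strict `lintegral` bound for a continuous nonnegative square integrand on the disc. -/
theorem integral_sq_lt_of_lintegral_lt {F : Type*} [NormedAddCommGroup F] {h : ℂ → F} (hc : Continuous h)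
    {δ X : ℝ} (hX : 0 < X)
    (hlt : ∫⁻ z in ball (0 : ℂ) δ, ‖h z‖ₑ ^ 2 < ENNReal.ofReal X) :
    ∫ z in ball (0 : ℂ) δ, ‖h z‖ ^ 2 < X := by
  have hint : IntegrableOn (fun z => ‖h z‖ ^ 2) (ball (0 : ℂ) δ) :=
    ((hc.norm.pow 2).continuousOn.integrableOn_compact (isCompact_closedBall (0 : ℂ) δ)).mono_set
      ball_subset_closedBall
  have heq : ∫⁻ z in ball (0 : ℂ) δ, ‖h z‖ₑ ^ 2 = ENNReal.ofReal (∫ z in ball (0 : ℂ) δ, ‖h z‖ ^ 2) := by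
    rw [ofReal_integral_eq_lintegral_ofReal hint (Filter.Eventually.of_forall fun z => sq_nonneg ‖h z‖)]
    refine lintegral_congr fun z => ?_
    rw [← ofReal_norm, ← ENNReal.ofReal_pow (norm_nonneg _)]
  rw [heq, ENNReal.ofReal_lt_ofReal_iff hX] at hlt
  exact hlt

end Summit.NavierStokesRegularity.NavierStokesRegularity.Theorems.PowerGaugeEulerLiouville.NeedleThinness
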